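import Mathlib
import HarnessLib
import Summits.HubbardSuperconductivity.HubbardSuperconductivity.Theorems.ChiralWindowDefsSector

/-!
# Certificate vocabulary: the BOX PART of the numerical hypothesis (crux `CwKLChiralWindow`, route `ChiralWindow`, line `Sketch`)

Companion of `Theorems/ChiralWindowDefs.lean` (record types), `…DefsResidual.lean` (residual-form block enclosures
`KLBlock.EnclosureR`) and `…DefsSector.lean` (node enclosures with sector row bounds `KLBox.NodeEnclosureS`, the named numerical
hypothesis `KLCert.EnclosuresRS`); crux item stmt-HubbardSuperconductivity-1741.

`KLCert.EnclosuresRS c` is by definition `E0(mua) ∧ E0(mub) ∧ (boxes)`.  The two filling inequalities E0 are THEOREMS for every record whose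
window lies in the bracket `[-111/100, -1]` (`stub_klFillingLower`, `stub_klFillingUpper`, transported by `monotone_filling`), so the
object of the certified interval-arithmetic computation is only the third conjunct.  This file NAMES it — `KLCert.BoxEnclosures c`: on every
box of the record, uniformly in `μ ∈ [mulo, muhi]`, the residual-form block enclosures E1, E2, E3R, E4 of the five channels and the
node-covering enclosures E5S, E6 — so that the tree's endpoint for a concrete record literal `klCert…` reads
`klCert….BoxEnclosures → CwKLChiralWindow` with nothing else left open.  Nothing is proved here beyond the definitional splitting.
-/

noncomputable section

namespace Summit.HubbardSuperconductivity.HubbardSuperconductivity.Theorems.CwKLChiralWindow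

set_option linter.dupNamespace false -- summit = problem name (single-conjunct summit), D-0017

open MeasureTheory Literature.MathematicalPhysics.QuantumLattice

namespace KLCert

/-- **The box part of the named numerical hypothesis** (interface E1, E2, E3R, E4, E5S, E6): on every box of the record, uniformly in
`μ ∈ [mulo, muhi]`, the residual-form enclosures of the five channel blocks and the node-covering enclosures with sector row bounds —
finitely many inequalities between explicit integrals against the Fermi-curve measures and the rationals of the record. [folklore] -/
def BoxEnclosures (c : KLCert) : Prop :=
  ∀ bx ∈ c.boxes, ∀ μ ∈ Set.Icc (bx.mulo : ℝ) (bx.muhi : ℝ),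
    (∀ χ : D4Irrep, (bx.blk χ).EnclosureR c.trials μ χ) ∧ bx.NodeEnclosureS c.trials μ

/-- The named numerical hypothesis splits definitionally into the two filling inequalities E0 and the box part. [folklore] -/
theorem enclosuresRS_iff : ∀ c : KLCert, c.EnclosuresRS ↔
    (KohnLuttinger.filling (squareDispersion 1 0) (c.mua : ℝ) ≤ 7 / 10 ∧
      (13 / 25 : ℝ) ≤ KohnLuttinger.filling (squareDispersion 1 0) (c.mub : ℝ) ∧ c.BoxEnclosures) :=
  fun _ => Iff.rfl

end KLCert

end Summit.HubbardSuperconductivity.HubbardSuperconductivity.Theorems.CwKLChiralWindow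

end
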